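import Summits.Ventures.HodgeRepro.Night1DivisorialWedge

/-!
# Non-vacuity of the divisor-generated part: the conjugate pairs `{(i, x), (i, c x)}` of every factor are
balanced (the Néron–Severi classes of `A_{T i}` on the model), so `D^k ≠ 0` for every `k ≤ |ι|`

Blind re-derivation cell `pub-hodge-repro`, seat `night-1` (gen 5, fourteenth file).  Imports night-1's
`Night1DivisorialWedge` (`IsBalancedPairing`, `coordWedgeOn_concatPairs_mem_divisorPowerIn`, `coordDual`).

The exceptional-class theorems of this gen (`W ⊓ D^k = 0`) would be empty if the divisor-generated part
`D^k` were `0`.  It is not: for a family of CM types `T` of `(G, c)` and any factor `i` and embedding `x`,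
the pair `{(i, x), (i, c x)}` is balanced for every conjugate product type — exactly one of `g⁻¹x`,
`g⁻¹cx = c g⁻¹x` lies in `T i` (`c` central, `T i` a CM type) — i.e. it is a divisor class of the factor
`A_{T i}` (the model of a Néron–Severi class of a CM abelian variety: Pohlmann's 2-sets `{s, c s}`).
Products of `k` such pairs on `k` distinct factors are nonzero elements of `D^k`:

* `conjPair_balanced` — the pair `{(i, x), (i, c x)}` has exactly one point in `prodTypeSet (g • T)`;
* `isBalancedPairing_conjPairs` — on `k` distinct factors `ι₀ : Fin k ↪ ι` the pairs `{(ι₀ j, x), (ι₀ j, c x)}`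
  form a balanced pairing, so **`coordWedgeOn_conjPairs_mem_divisorPowerIn`** — their wedge lies in `D^k`
  — and it is nonzero (`coordWedgeOn_conjPairs_ne_zero`: the `2k` points are distinct since `c ≠ 1`);
* **`divisorPowerIn_ne_bot`** — `D^k ≠ ⊥` whenever `k` distinct factors exist.

Nothing geometric is built; nothing here says anything about the status of the Hodge conjecture for CM
abelian varieties, which is NOT proved.
-/

set_option autoImplicit false

open Finset Module
open scoped Pointwise

namespace HodgeRepro.RouteC

open CMHodgeOn

section Nonvacuity

variable {G : Type*} [Group G] [DecidableEq G] [Fintype G] {ι : Type*} [Fintype ι] [DecidableEq ι]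

/-- The conjugate pair `{(i, x), (i, c x)}` of the factor `i`. -/
def conjPair (c : G) (i : ι) (x : G) : Fin 2 → ι × G := ![(i, x), (i, c * x)]

omit [DecidableEq G] [Fintype G] [Fintype ι] [DecidableEq ι] in
/-- The conjugate pair is injective (`c ≠ 1`). -/
theorem conjPair_injective {c : G} (hc : IsComplexConj c) (i : ι) (x : G) :
    Function.Injective (conjPair c i x) := by
  intro a b hab
  have hne : x ≠ c * x := fun h => hc.ne_one (by simpa using h.symm)
  fin_cases a <;> fin_cases b <;> simp_all [conjPair]

/-- **The conjugate pair of a factor is balanced** for every conjugate product type: exactly one of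
`g⁻¹ x ∈ T i`, `c g⁻¹ x ∈ T i` holds (`T i` a CM type, `c` central). -/
theorem conjPair_balanced {c : G} (hc : IsComplexConj c) {T : ι → Finset G} (hT : ∀ i, IsCMType c (T i))
    (i : ι) (x : G) (g : G) :
    (univ.image (conjPair c i x) ∩ prodTypeSet fun i => g • T i).card = 1 := by
  rw [card_image_pair_inter_eq_one_iff (conjPair_injective hc i x)]
  simp only [conjPair, Matrix.cons_val_zero, Matrix.cons_val_one, Matrix.cons_val_fin_one, prodTypeSet,
    mem_filter, mem_univ, true_and]
  rw [← Finset.inv_smul_mem_iff, ← Finset.inv_smul_mem_iff, smul_eq_mul, smul_eq_mul, ← mul_assoc,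
    ← hc.comm g⁻¹, mul_assoc, (hT i).conj_mem_iff, not_not]

/-- On `k` distinct factors the conjugate pairs form a balanced pairing. -/
theorem isBalancedPairing_conjPairs {c : G} (hc : IsComplexConj c) {T : ι → Finset G}
    (hT : ∀ i, IsCMType c (T i)) {k : ℕ} (ι₀ : Fin k → ι) (x : Fin k → G) :
    IsBalancedPairing (fun g : G => prodTypeSet fun i => g • T i)
      (fun j => conjPair c (ι₀ j) (x j)) :=
  fun _ => ⟨conjPair_injective hc _ _, conjPair_balanced hc hT _ _⟩

/-- **Products of conjugate pairs of distinct factors are `k`-fold products of divisor classes.** -/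
theorem coordWedgeOn_conjPairs_mem_divisorPowerIn {c : G} (hc : IsComplexConj c) {T : ι → Finset G}
    (hT : ∀ i, IsCMType c (T i)) {k : ℕ} (ι₀ : Fin k → ι) (x : Fin k → G) :
    coordWedgeOn (2 * k) (concatPairs fun j => conjPair c (ι₀ j) (x j)) ∈
      divisorPowerIn (fun g : G => prodTypeSet fun i => g • T i) k :=
  coordWedgeOn_concatPairs_mem_divisorPowerIn _ (isBalancedPairing_conjPairs hc hT ι₀ x)

omit [Group G] [DecidableEq G] [Fintype G] [Fintype ι] [DecidableEq ι] in
/-- A concatenation of injective pairs with pairwise disjoint ranges is injective. -/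
theorem concatPairs_injective_of {X : Type*} {k : ℕ} {s : Fin k → Fin 2 → X}
    (hinj : ∀ j, Function.Injective (s j)) (hdisj : ∀ j j' b b', s j b = s j' b' → j = j') :
    Function.Injective (concatPairs s) := by
  induction k with
  | zero =>
    intro a
    exact a.elim0
  | succ k ih =>
    show Function.Injective (Fin.append (concatPairs fun j => s j.castSucc) (s (Fin.last k)))
    rw [Fin.append_injective_iff]
    refine ⟨ih (fun j => hinj _) (fun j j' b b' h => Fin.castSucc_injective _ (hdisj _ _ _ _ h)),
      hinj _, ?_⟩
    intro i b h
    obtain ⟨j, b', hj⟩ := (mem_range_concatPairs _ _).1 (Set.mem_range_self i)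
    rw [← hj] at h
    exact (Fin.castSucc_lt_last j).ne (hdisj _ _ _ _ h)

omit [DecidableEq G] [Fintype G] [Fintype ι] [DecidableEq ι] in
/-- The concatenation of conjugate pairs on distinct factors is injective (`c ≠ 1`). -/
theorem concatPairs_conjPairs_injective {c : G} (hc : IsComplexConj c) {k : ℕ} {ι₀ : Fin k → ι}
    (hι : Function.Injective ι₀) (x : Fin k → G) :
    Function.Injective (concatPairs fun j => conjPair c (ι₀ j) (x j)) := by
  refine concatPairs_injective_of (fun j => conjPair_injective hc _ _) fun j j' b b' h => ?_
  have h1 := congrArg Prod.fst h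
  fin_cases b <;> fin_cases b' <;> simp only [conjPair, Matrix.cons_val_zero, Matrix.cons_val_one,
    Matrix.cons_val_fin_one, Fin.zero_eta, Fin.mk_one, Fin.isValue] at h1 <;> exact hι h1

omit [Fintype G] [Fintype ι] in
/-- The wedge of conjugate pairs on distinct factors is nonzero. -/
theorem coordWedgeOn_conjPairs_ne_zero {c : G} (hc : IsComplexConj c) {k : ℕ} {ι₀ : Fin k → ι}
    (hι : Function.Injective ι₀) (x : Fin k → G) :
    coordWedgeOn (2 * k) (concatPairs fun j => conjPair c (ι₀ j) (x j)) ≠ 0 :=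
  coordWedgeOn_ne_zero (concatPairs_conjPairs_injective hc hι x)

/-- **`D^k ≠ ⊥`** whenever `k` distinct factors exist: the exceptional-class theorems are not vacuous. -/
theorem divisorPowerIn_ne_bot {c : G} (hc : IsComplexConj c) {T : ι → Finset G}
    (hT : ∀ i, IsCMType c (T i)) {k : ℕ} {ι₀ : Fin k → ι} (hι : Function.Injective ι₀) :
    divisorPowerIn (fun g : G => prodTypeSet fun i => g • T i) k ≠ ⊥ := by
  intro h
  have hmem := coordWedgeOn_conjPairs_mem_divisorPowerIn hc hT ι₀ fun _ => (1 : G)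
  rw [h, Submodule.mem_bot] at hmem
  exact coordWedgeOn_conjPairs_ne_zero hc hι (fun _ => (1 : G)) hmem

end Nonvacuity

end HodgeRepro.RouteC
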